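import Summits.HubbardSuperconductivity.HubbardSuperconductivity.Theorems.WeakCouplingBCSWcbcsSsbToTorusLROPointwise
import Summits.HubbardSuperconductivity.HubbardSuperconductivity.Theorems.WeakCouplingBCSWcbcsBcsConstructionThinSufficiency
import HarnessLib

/-!
# Crux `WcbcsSsbToTorusLRO` (stmt-HubbardSuperconductivity-2009), line `off-zero-mode-moment-closure` ⊕ N-half:
# the ROBUST transfer from ROBUST-guarded children (T), (N), (C)

Lead c4 (prover-line-stmt-HubbardSuperconductivity-2009-c4-0), 2026-08-17.  Companion of
`Theorems/WeakCouplingBCSWcbcsSsbToTorusLRORobustThinGlue.lean` (robust transfer + thin order ⇒ summit).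

The crux's standing disproof (`Cruxes/WcbcsSsbToTorusLRO/Disproof.lean` §4–§5) recommends the ROBUST transfer — hypothesis
`∀ᶠ μ' in 𝓝 μ, HasDWaveOrder U μ'` (order on a neighbourhood of the density-matched `μ`) instead of `HasDWaveOrder U μ` — because the
pointwise form carries a first-order ENDPOINT hazard; the robust transfer is WEAKER than the typed crux.  If the planner restates crux 2
that way, the line's three registered stubs (T) `stub_torusPairStiffness`, (N) `stub_neutralCurvature`, (C) `stub_chargingFloor`
(SPLIT-TNC children) may be filed with the SAME robust guard — each child then WEAKER than its registered form — and the glue survives: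

* `robustTransfer_of_robustChildren` — robust-guarded (T) → robust-guarded (N) → robust-guarded (C) → robust transfer, by the landed
  POINTWISE composition `hasDWavePairFieldLROAt_of_stiffness_curvature_charging_at` (p141333) at each guarded `(U, δ, μ)`
  (`HasDWaveOrder U μ` itself is recovered from the neighbourhood by `Filter.Eventually.self_of_nhds`);
* `robustChild_of_child_T/N/C` — each registered (pointwise-guarded) stub implies its robust-guarded form (bookkeeping);
* `hubbardSuperconductivity_of_robustChildren_of_thinOrder` — END TO END: robust-guarded (T), (N), (C) and THIN ORDER
  (`∀ U₁ > 0 ∃ U ∈ (0,U₁) ∃ -21/25 ≤ a < b ≤ -7/20 ∀ μ ∈ (a,b), HasDWaveOrder U μ`, the reduced form of the sibling crux stmt-2010,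
  p144261) imply the SUMMIT `HubbardSuperconductivity` — density matching for free by the landed (T1)–(T3) of the sibling line
  (`stub_aeDensityMatching (stub_densityInsideUnitWindow stub_freeLevelCountsOuter)`), the open interval of order is the neighbourhood.
  So after the recommended restatements (crux 2 := robust transfer, split into robust T/N/C; crux 4 := thin order) the route's whole
  open content is these four physical statements and nothing else.

Sorry-free, standard axioms, no definition, no named fact; the physics stays in the three hypotheses.
References: T. Koma, H. Tasaki, J. Stat. Phys. 76 (1994) 745, §1; C. Borgs, R. Kotecký, J. Stat. Phys. 61 (1990) 79.
-/

noncomputable section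

set_option linter.dupNamespace false

namespace Summit.HubbardSuperconductivity.HubbardSuperconductivity.Theorems.WcbcsSsbToTorusLRO

open Literature.MathematicalPhysics.QuantumLattice Literature.Probability.LatticeModels
open Matrix Filter Set
open scoped ComplexOrder ComplexConjugate Topology

/-- **Robust transfer from robust-guarded children.** If, on a common weak-coupling window, at every `(U, δ, μ)` with density
matching and `d`-wave order on a NEIGHBOURHOOD of `μ`, the three bodies hold — (T) torus pair stiffness, (N) the h-uniform
neutral-curvature floor, (C) the charging floor at the pinned filling — then the ROBUST transfer holds: density matching and order
near `μ` give `HasDWavePairFieldLROAt U δ`.  Windows are intersected; at each point the landed pointwise composition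
`hasDWavePairFieldLROAt_of_stiffness_curvature_charging_at` is applied with `HasDWaveOrder U μ := (order nearby).self_of_nhds`.
[cite: KomaTasaki1994, §1] -/
theorem robustTransfer_of_robustChildren :
    (∃ U₀ : ℝ, 0 < U₀ ∧ ∀ U ∈ Set.Ioo (0:ℝ) U₀, ∀ δ ∈ Set.Ioo (0:ℝ) (1 / 2), ∀ μ : ℝ, Filter.Tendsto (fun L : ℕ => ((hubbardTorusWith 2 (L + 1) 1 U μ).groundStateFunctional totalNumber).re / ((L + 1 : ℕ) : ℝ) ^ 2) Filter.atTop (nhds (1 - δ)) → (∀ᶠ μ' in nhds μ, HasDWaveOrder U μ') → ∃ C η : ℝ, 0 < η ∧ ∀ᶠ k : ℕ in Filter.atTop, ∀ ψ : Fock (Orb (FermionTorus 2 (2 * k + 1 + 1))), IsGroundStateInSector (hubbardTorus 2 (2 * k + 1 + 1) 1 U) (2 * ⌊(1 - δ) * ((2 * k + 1 + 1 : ℕ) : ℝ) ^ 2 / 2⌋₊) 0 ψ → star ψ ⬝ᵥ ψ = 1 → ∀ m : TorusSite 2 (2 * k + 1 + 1), m ≠ 0 → momentumNormSq (2 * k +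 1 + 1) m < η ^ 2 → (∀ w : Fock (Orb (FermionTorus 2 (2 * k + 1 + 1))), w ∈ szSector (Λ := FermionTorus 2 (2 * k + 1 + 1)) (2 * ⌊(1 - δ) * ((2 * k + 1 + 1 : ℕ) : ℝ) ^ 2 / 2⌋₊ - 2) 0 → 2 * (star w ⬝ᵥ (pairFieldAt dWaveFormFactor (2 * k + 1 + 1) m *ᵥ ψ)).re - ((star w ⬝ᵥ (hubbardTorus 2 (2 * k + 1 + 1) 1 U *ᵥ w)).re - (hubbardTorus 2 (2 * k + 1 + 1) 1 U).minEnergyOn (szSector (2 * ⌊(1 - δ) * ((2 * k + 1 + 1 : ℕ) : ℝ) ^ 2 / 2⌋₊ - 2) 0) * (star w ⬝ᵥ w).re) ≤ C * ((2 * k + 1 + 1 : ℕ) : ℝ) ^ 2 / momentumNormSq (2 * k + 1 + 1) m) ∧ (∀ w : Fock (Orb (FermionTorus 2 (2 * k + 1 + 1))), w ∈ szSector (Λ := FermionTorus 2 (2 * k + 1 + 1)) (2 * ⌊(1 - δ) * ((2 * k + 1 + 1 : ℕ) : ℝ) ^ 2 / 2⌋₊ + 2) 0 → 2 * (star w ⬝ᵥ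 ((pairFieldAt dWaveFormFactor (2 * k + 1 + 1) m)ᴴ *ᵥ ψ)).re - ((star w ⬝ᵥ (hubbardTorus 2 (2 * k + 1 + 1) 1 U *ᵥ w)).re - (hubbardTorus 2 (2 * k + 1 + 1) 1 U).minEnergyOn (szSector (2 * ⌊(1 - δ) * ((2 * k + 1 + 1 : ℕ) : ℝ) ^ 2 / 2⌋₊ + 2) 0) * (star w ⬝ᵥ w).re) ≤ C * ((2 * k + 1 + 1 : ℕ) : ℝ) ^ 2 / momentumNormSq (2 * k + 1 + 1) m)) → (∃ U₀ : ℝ, 0 < U₀ ∧ ∀ U ∈ Set.Ioo (0:ℝ) U₀, ∀ δ ∈ Set.Ioo (0:ℝ) (1 / 2), ∀ μ : ℝ, Filter.Tendsto (fun L : ℕ => ((hubbardTorusWith 2 (L + 1) 1 U μ).groundStateFunctional totalNumber).re / ((L + 1 : ℕ) : ℝ) ^ 2) Filter.atTop (nhds (1 - δ)) → (∀ᶠ μ' in nhds μ, HasDWaveOrder U μ') → ∀ R : ℕ, 0 < R → ∃ C : ℝ, 0 ≤ C ∧ ∃ κ₀ : ℝ, 0 < κ₀ ∧ ∃ h₀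 : ℝ, 0 < h₀ ∧ ∀ κ ∈ Set.Ioo (0:ℝ) κ₀, ∀ h ∈ Set.Ioo (0:ℝ) h₀, ∀ᶠ L : ℕ in Filter.atTop, -C * κ ^ 2 * ((L + 1 : ℕ) : ℝ) ^ 2 ≤ (dWaveSourceTorus (L + 1) U μ h + (κ : ℂ) • (((((R : ℝ) ^ 4)⁻¹ : ℝ) : ℂ) • ∑ a : Literature.Probability.LatticeModels.TorusSite 2 (L + 1), (∑ u : Fin 2 → Fin R, localPair dWaveFormFactor (L + 1) (a + fun i => ((u i : ℕ) : ZMod (L + 1))))ᴴ * (∑ u : Fin 2 → Fin R, localPair dWaveFormFactor (L + 1) (a + fun i => ((u i : ℕ) : ZMod (L + 1)))))).groundEnergy + (dWaveSourceTorus (L + 1) U μ h + ((-κ : ℝ) : ℂ) • (((((R : ℝ) ^ 4)⁻¹ : ℝ) : ℂ) • ∑ a : Literature.Probability.LatticeModels.TorusSite 2 (L + 1), (∑ u : Fin 2 → Fin R, localPair dWaveFormFactor (L + 1) (a + fun i => ((u i : ℕ) : ZMod (L + 1))))ᴴ * (∑ u : Fin 2 → Fin R, localPair dWaveFormFactor (L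 + 1) (a + fun i => ((u i : ℕ) : ZMod (L + 1)))))).groundEnergy - 2 * (dWaveSourceTorus (L + 1) U μ h).groundEnergy) → (∃ U₀ : ℝ, 0 < U₀ ∧ ∀ U ∈ Set.Ioo (0:ℝ) U₀, ∀ δ ∈ Set.Ioo (0:ℝ) (1 / 2), ∀ μ : ℝ, Filter.Tendsto (fun L : ℕ => ((hubbardTorusWith 2 (L + 1) 1 U μ).groundStateFunctional totalNumber).re / ((L + 1 : ℕ) : ℝ) ^ 2) Filter.atTop (nhds (1 - δ)) → (∀ᶠ μ' in nhds μ, HasDWaveOrder U μ') → ∀ ε : ℝ, 0 < ε → ∀ᶠ k : ℕ in Filter.atTop, -ε ≤ (1 + Real.log ((2 * k + 1 + 1 : ℕ) : ℝ)) * pairGap (hubbardTorus 2 (2 * k + 1 + 1) 1 U) (2 * ⌊(1 - δ) * ((2 * k + 1 + 1 : ℕ) : ℝ) ^ 2 / 2⌋₊)) → ∃ U₀ : ℝ, 0 < U₀ ∧ ∀ U ∈ Set.Ioo (0:ℝ) U₀, ∀ δ ∈ Set.Ioo (0:ℝ) (1 / 2), ∀ μ : ℝ, Filter.Tendsto (fun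 L : ℕ => ((hubbardTorusWith 2 (L + 1) 1 U μ).groundStateFunctional totalNumber).re / ((L + 1 : ℕ) : ℝ) ^ 2) Filter.atTop (nhds (1 - δ)) → (∀ᶠ μ' in nhds μ, HasDWaveOrder U μ') → Literature.Barriers.HubbardSuperconductivity.HasDWavePairFieldLROAt U δ := by
  intro hT hN hC
  obtain ⟨U₁, hU₁, hT⟩ := hT
  obtain ⟨U₂, hU₂, hN⟩ := hN
  obtain ⟨U₃, hU₃, hC⟩ := hC
  refine ⟨min U₁ (min U₂ U₃), lt_min hU₁ (lt_min hU₂ hU₃), fun U hU δ hδ μ hdm hnb => ?_⟩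
  have hU1 : U ∈ Set.Ioo (0:ℝ) U₁ := ⟨hU.1, lt_of_lt_of_le hU.2 (min_le_left _ _)⟩
  have hU2 : U ∈ Set.Ioo (0:ℝ) U₂ := ⟨hU.1, lt_of_lt_of_le hU.2 ((min_le_right _ _).trans (min_le_left _ _))⟩
  have hU3 : U ∈ Set.Ioo (0:ℝ) U₃ := ⟨hU.1, lt_of_lt_of_le hU.2 ((min_le_right _ _).trans (min_le_right _ _))⟩
  exact hasDWavePairFieldLROAt_of_stiffness_curvature_charging_at U δ μ hU.1 hδ (hT U hU1 δ hδ μ hdm hnb)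
    (hN U hU2 δ hδ μ hdm hnb) (hC U hU3 δ hδ μ hdm hnb) hdm hnb.self_of_nhds

/-- **(T) registered ⇒ (T) robust-guarded** (a neighbourhood of order contains the point). [cite: KomaTasaki1994, §1] -/
theorem robustChild_of_child_T :
    (∃ U₀ : ℝ, 0 < U₀ ∧ ∀ U ∈ Set.Ioo (0:ℝ) U₀, ∀ δ ∈ Set.Ioo (0:ℝ) (1 / 2), ∀ μ : ℝ, Filter.Tendsto (fun L : ℕ => ((hubbardTorusWith 2 (L + 1) 1 U μ).groundStateFunctional totalNumber).re / ((L + 1 : ℕ) : ℝ) ^ 2) Filter.atTop (nhds (1 - δ)) → HasDWaveOrder U μ → ∃ C η : ℝ, 0 < η ∧ ∀ᶠ k : ℕ in Filter.atTop, ∀ ψ : Fock (Orb (FermionTorus 2 (2 * k + 1 + 1))), IsGroundStateInSector (hubbardTorus 2 (2 * k + 1 + 1) 1 U) (2 * ⌊(1 - δ) * ((2 * k + 1 + 1 : ℕ) : ℝ) ^ 2 / 2⌋₊) 0 ψ → star ψ ⬝ᵥ ψ = 1 → ∀ m : TorusSite 2 (2 * k + 1 + 1), m ≠ 0 → momentumNormSq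 (2 * k + 1 + 1) m < η ^ 2 → (∀ w : Fock (Orb (FermionTorus 2 (2 * k + 1 + 1))), w ∈ szSector (Λ := FermionTorus 2 (2 * k + 1 + 1)) (2 * ⌊(1 - δ) * ((2 * k + 1 + 1 : ℕ) : ℝ) ^ 2 / 2⌋₊ - 2) 0 → 2 * (star w ⬝ᵥ (pairFieldAt dWaveFormFactor (2 * k + 1 + 1) m *ᵥ ψ)).re - ((star w ⬝ᵥ (hubbardTorus 2 (2 * k + 1 + 1) 1 U *ᵥ w)).re - (hubbardTorus 2 (2 * k + 1 + 1) 1 U).minEnergyOn (szSector (2 * ⌊(1 - δ) * ((2 * k + 1 + 1 : ℕ) : ℝ) ^ 2 / 2⌋₊ - 2) 0) * (star w ⬝ᵥ w).re) ≤ C * ((2 * k + 1 + 1 : ℕ) : ℝ) ^ 2 / momentumNormSq (2 * k + 1 + 1) m) ∧ (∀ w : Fock (Orb (FermionTorus 2 (2 * k + 1 + 1))), w ∈ szSector (Λ := FermionTorus 2 (2 * k + 1 + 1)) (2 * ⌊(1 - δ) * ((2 * k + 1 + 1 : ℕ) : ℝ) ^ 2 / 2⌋₊ + 2) 0 → 2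 * (star w ⬝ᵥ ((pairFieldAt dWaveFormFactor (2 * k + 1 + 1) m)ᴴ *ᵥ ψ)).re - ((star w ⬝ᵥ (hubbardTorus 2 (2 * k + 1 + 1) 1 U *ᵥ w)).re - (hubbardTorus 2 (2 * k + 1 + 1) 1 U).minEnergyOn (szSector (2 * ⌊(1 - δ) * ((2 * k + 1 + 1 : ℕ) : ℝ) ^ 2 / 2⌋₊ + 2) 0) * (star w ⬝ᵥ w).re) ≤ C * ((2 * k + 1 + 1 : ℕ) : ℝ) ^ 2 / momentumNormSq (2 * k + 1 + 1) m)) → (∃ U₀ : ℝ, 0 < U₀ ∧ ∀ U ∈ Set.Ioo (0:ℝ) U₀, ∀ δ ∈ Set.Ioo (0:ℝ) (1 / 2), ∀ μ : ℝ, Filter.Tendsto (fun L : ℕ => ((hubbardTorusWith 2 (L + 1) 1 U μ).groundStateFunctional totalNumber).re / ((L + 1 : ℕ) : ℝ) ^ 2) Filter.atTop (nhds (1 - δ)) → (∀ᶠ μ' in nhds μ, HasDWaveOrder U μ') → ∃ C η : ℝ, 0 < η ∧ ∀ᶠ k : ℕ in Filter.atTop, ∀ ψ : Fock (Orb (FermionTorus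 2 (2 * k + 1 + 1))), IsGroundStateInSector (hubbardTorus 2 (2 * k + 1 + 1) 1 U) (2 * ⌊(1 - δ) * ((2 * k + 1 + 1 : ℕ) : ℝ) ^ 2 / 2⌋₊) 0 ψ → star ψ ⬝ᵥ ψ = 1 → ∀ m : TorusSite 2 (2 * k + 1 + 1), m ≠ 0 → momentumNormSq (2 * k + 1 + 1) m < η ^ 2 → (∀ w : Fock (Orb (FermionTorus 2 (2 * k + 1 + 1))), w ∈ szSector (Λ := FermionTorus 2 (2 * k + 1 + 1)) (2 * ⌊(1 - δ) * ((2 * k + 1 + 1 : ℕ) : ℝ) ^ 2 / 2⌋₊ - 2) 0 → 2 * (star w ⬝ᵥ (pairFieldAt dWaveFormFactor (2 * k + 1 + 1) m *ᵥ ψ)).re - ((star w ⬝ᵥ (hubbardTorus 2 (2 * k + 1 + 1) 1 U *ᵥ w)).re - (hubbardTorus 2 (2 * k + 1 + 1) 1 U).minEnergyOn (szSector (2 * ⌊(1 - δ) * ((2 * k + 1 + 1 : ℕ) : ℝ) ^ 2 / 2⌋₊ - 2) 0) * (star w ⬝ᵥ w).re) ≤ C * ((2 * k + 1 + 1 : ℕ)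 : ℝ) ^ 2 / momentumNormSq (2 * k + 1 + 1) m) ∧ (∀ w : Fock (Orb (FermionTorus 2 (2 * k + 1 + 1))), w ∈ szSector (Λ := FermionTorus 2 (2 * k + 1 + 1)) (2 * ⌊(1 - δ) * ((2 * k + 1 + 1 : ℕ) : ℝ) ^ 2 / 2⌋₊ + 2) 0 → 2 * (star w ⬝ᵥ ((pairFieldAt dWaveFormFactor (2 * k + 1 + 1) m)ᴴ *ᵥ ψ)).re - ((star w ⬝ᵥ (hubbardTorus 2 (2 * k + 1 + 1) 1 U *ᵥ w)).re - (hubbardTorus 2 (2 * k + 1 + 1) 1 U).minEnergyOn (szSector (2 * ⌊(1 - δ) * ((2 * k + 1 + 1 : ℕ) : ℝ) ^ 2 / 2⌋₊ + 2) 0) * (star w ⬝ᵥ w).re) ≤ C * ((2 * k + 1 + 1 : ℕ) : ℝ) ^ 2 / momentumNormSq (2 * k + 1 + 1) m)) := by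
  rintro ⟨U₀, hU₀, h⟩
  exact ⟨U₀, hU₀, fun U hU δ hδ μ hdm hnb => h U hU δ hδ μ hdm hnb.self_of_nhds⟩

/-- **(N) registered ⇒ (N) robust-guarded.** [cite: KomaTasaki1994, §1] -/
theorem robustChild_of_child_N :
    (∃ U₀ : ℝ, 0 < U₀ ∧ ∀ U ∈ Set.Ioo (0:ℝ) U₀, ∀ δ ∈ Set.Ioo (0:ℝ) (1 / 2), ∀ μ : ℝ, Filter.Tendsto (fun L : ℕ => ((hubbardTorusWith 2 (L + 1) 1 U μ).groundStateFunctional totalNumber).re / ((L + 1 : ℕ) : ℝ) ^ 2) Filter.atTop (nhds (1 - δ)) → HasDWaveOrder U μ → ∀ R : ℕ, 0 < R → ∃ C : ℝ, 0 ≤ C ∧ ∃ κ₀ : ℝ, 0 < κ₀ ∧ ∃ h₀ : ℝ, 0 < h₀ ∧ ∀ κ ∈ Set.Ioo (0:ℝ) κ₀, ∀ h ∈ Set.Ioo (0:ℝ) h₀, ∀ᶠ L : ℕ in Filter.atTop, -C * κ ^ 2 * ((L + 1 : ℕ) : ℝ) ^ 2 ≤ (dWaveSourceTorus (L + 1) U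 μ h + (κ : ℂ) • (((((R : ℝ) ^ 4)⁻¹ : ℝ) : ℂ) • ∑ a : Literature.Probability.LatticeModels.TorusSite 2 (L + 1), (∑ u : Fin 2 → Fin R, localPair dWaveFormFactor (L + 1) (a + fun i => ((u i : ℕ) : ZMod (L + 1))))ᴴ * (∑ u : Fin 2 → Fin R, localPair dWaveFormFactor (L + 1) (a + fun i => ((u i : ℕ) : ZMod (L + 1)))))).groundEnergy + (dWaveSourceTorus (L + 1) U μ h + ((-κ : ℝ) : ℂ) • (((((R : ℝ) ^ 4)⁻¹ : ℝ) : ℂ) • ∑ a : Literature.Probability.LatticeModels.TorusSite 2 (L + 1), (∑ u : Fin 2 → Fin R, localPair dWaveFormFactor (L + 1) (a + fun i => ((u i : ℕ) : ZMod (L + 1))))ᴴ * (∑ u : Fin 2 → Fin R, localPair dWaveFormFactor (L + 1) (a + fun i => ((u i : ℕ) : ZMod (L + 1)))))).groundEnergy - 2 * (dWaveSourceTorus (L + 1) U μ h).groundEnergy) → (∃ U₀ : ℝ, 0 < U₀ ∧ ∀ U ∈ Set.Ioo (0:ℝ) U₀, ∀ δ ∈ Set.Ioo (0:ℝ) (1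 / 2), ∀ μ : ℝ, Filter.Tendsto (fun L : ℕ => ((hubbardTorusWith 2 (L + 1) 1 U μ).groundStateFunctional totalNumber).re / ((L + 1 : ℕ) : ℝ) ^ 2) Filter.atTop (nhds (1 - δ)) → (∀ᶠ μ' in nhds μ, HasDWaveOrder U μ') → ∀ R : ℕ, 0 < R → ∃ C : ℝ, 0 ≤ C ∧ ∃ κ₀ : ℝ, 0 < κ₀ ∧ ∃ h₀ : ℝ, 0 < h₀ ∧ ∀ κ ∈ Set.Ioo (0:ℝ) κ₀, ∀ h ∈ Set.Ioo (0:ℝ) h₀, ∀ᶠ L : ℕ in Filter.atTop, -C * κ ^ 2 * ((L + 1 : ℕ) : ℝ) ^ 2 ≤ (dWaveSourceTorus (L + 1) U μ h + (κ : ℂ) • (((((R : ℝ) ^ 4)⁻¹ : ℝ) : ℂ) • ∑ a : Literature.Probability.LatticeModels.TorusSite 2 (L + 1), (∑ u : Fin 2 → Fin R, localPair dWaveFormFactor (L + 1) (a + fun i => ((u i : ℕ) : ZMod (L + 1))))ᴴ * (∑ u : Fin 2 → Fin R, localPair dWaveFormFactor (L + 1) (a + fun i => ((u i : ℕ) : ZMod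 (L + 1)))))).groundEnergy + (dWaveSourceTorus (L + 1) U μ h + ((-κ : ℝ) : ℂ) • (((((R : ℝ) ^ 4)⁻¹ : ℝ) : ℂ) • ∑ a : Literature.Probability.LatticeModels.TorusSite 2 (L + 1), (∑ u : Fin 2 → Fin R, localPair dWaveFormFactor (L + 1) (a + fun i => ((u i : ℕ) : ZMod (L + 1))))ᴴ * (∑ u : Fin 2 → Fin R, localPair dWaveFormFactor (L + 1) (a + fun i => ((u i : ℕ) : ZMod (L + 1)))))).groundEnergy - 2 * (dWaveSourceTorus (L + 1) U μ h).groundEnergy) := by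
  rintro ⟨U₀, hU₀, h⟩
  exact ⟨U₀, hU₀, fun U hU δ hδ μ hdm hnb => h U hU δ hδ μ hdm hnb.self_of_nhds⟩

/-- **(C) registered ⇒ (C) robust-guarded.** [cite: KomaTasaki1994, §1] -/
theorem robustChild_of_child_C :
    (∃ U₀ : ℝ, 0 < U₀ ∧ ∀ U ∈ Set.Ioo (0:ℝ) U₀, ∀ δ ∈ Set.Ioo (0:ℝ) (1 / 2), ∀ μ : ℝ, Filter.Tendsto (fun L : ℕ => ((hubbardTorusWith 2 (L + 1) 1 U μ).groundStateFunctional totalNumber).re / ((L + 1 : ℕ) : ℝ) ^ 2) Filter.atTop (nhds (1 - δ)) → HasDWaveOrder U μ → ∀ ε : ℝ, 0 < ε → ∀ᶠ k : ℕ in Filter.atTop, -ε ≤ (1 + Real.log ((2 * k + 1 + 1 : ℕ) : ℝ)) * pairGap (hubbardTorus 2 (2 * k + 1 + 1) 1 U) (2 * ⌊(1 - δ) * ((2 * k + 1 + 1 : ℕ) : ℝ) ^ 2 / 2⌋₊)) → (∃ U₀ : ℝ, 0 < U₀ ∧ ∀ U ∈ Set.Ioo (0:ℝ) U₀, ∀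 δ ∈ Set.Ioo (0:ℝ) (1 / 2), ∀ μ : ℝ, Filter.Tendsto (fun L : ℕ => ((hubbardTorusWith 2 (L + 1) 1 U μ).groundStateFunctional totalNumber).re / ((L + 1 : ℕ) : ℝ) ^ 2) Filter.atTop (nhds (1 - δ)) → (∀ᶠ μ' in nhds μ, HasDWaveOrder U μ') → ∀ ε : ℝ, 0 < ε → ∀ᶠ k : ℕ in Filter.atTop, -ε ≤ (1 + Real.log ((2 * k + 1 + 1 : ℕ) : ℝ)) * pairGap (hubbardTorus 2 (2 * k + 1 + 1) 1 U) (2 * ⌊(1 - δ) * ((2 * k + 1 + 1 : ℕ) : ℝ) ^ 2 / 2⌋₊)) := by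
  rintro ⟨U₀, hU₀, h⟩
  exact ⟨U₀, hU₀, fun U hU δ hδ μ hdm hnb => h U hU δ hδ μ hdm hnb.self_of_nhds⟩

/-- **END TO END: robust-guarded (T), (N), (C) and thin order give the summit.** From the three robust-guarded children obtain the
robust transfer (`robustTransfer_of_robustChildren`); the sibling line's landed density matching
(`stub_aeDensityMatching (stub_densityInsideUnitWindow stub_freeLevelCountsOuter)`: for `U ≤ U₃` every open sub-interval of
`[-21/25,-7/20]` contains a density-matched `μ` with `δ ∈ (0,1/2)`) places `(δ, μ)` inside thin order's interval `(a,b)`, which is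
a neighbourhood of `μ`; the transfer gives `HasDWavePairFieldLROAt U δ`, i.e. the summit at `(U, δ)`. [cite: KomaTasaki1994, §1] -/
theorem hubbardSuperconductivity_of_robustChildren_of_thinOrder :
    (∃ U₀ : ℝ, 0 < U₀ ∧ ∀ U ∈ Set.Ioo (0:ℝ) U₀, ∀ δ ∈ Set.Ioo (0:ℝ) (1 / 2), ∀ μ : ℝ, Filter.Tendsto (fun L : ℕ => ((hubbardTorusWith 2 (L + 1) 1 U μ).groundStateFunctional totalNumber).re / ((L + 1 : ℕ) : ℝ) ^ 2) Filter.atTop (nhds (1 - δ)) → (∀ᶠ μ' in nhds μ, HasDWaveOrder U μ') → ∃ C η : ℝ, 0 < η ∧ ∀ᶠ k : ℕ in Filter.atTop, ∀ ψ : Fock (Orb (FermionTorus 2 (2 * k + 1 + 1))), IsGroundStateInSector (hubbardTorus 2 (2 * k + 1 + 1) 1 U) (2 * ⌊(1 - δ) * ((2 * k + 1 + 1 : ℕ) : ℝ) ^ 2 / 2⌋₊) 0 ψ → star ψ ⬝ᵥ ψ = 1 → ∀ m : TorusSite 2 (2 * k + 1 + 1), m ≠ 0 → momentumNormSq (2 *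 k + 1 + 1) m < η ^ 2 → (∀ w : Fock (Orb (FermionTorus 2 (2 * k + 1 + 1))), w ∈ szSector (Λ := FermionTorus 2 (2 * k + 1 + 1)) (2 * ⌊(1 - δ) * ((2 * k + 1 + 1 : ℕ) : ℝ) ^ 2 / 2⌋₊ - 2) 0 → 2 * (star w ⬝ᵥ (pairFieldAt dWaveFormFactor (2 * k + 1 + 1) m *ᵥ ψ)).re - ((star w ⬝ᵥ (hubbardTorus 2 (2 * k + 1 + 1) 1 U *ᵥ w)).re - (hubbardTorus 2 (2 * k + 1 + 1) 1 U).minEnergyOn (szSector (2 * ⌊(1 - δ) * ((2 * k + 1 + 1 : ℕ) : ℝ) ^ 2 / 2⌋₊ - 2) 0) * (star w ⬝ᵥ w).re) ≤ C * ((2 * k + 1 + 1 : ℕ) : ℝ) ^ 2 / momentumNormSq (2 * k + 1 + 1) m) ∧ (∀ w : Fock (Orb (FermionTorus 2 (2 * k + 1 + 1))), w ∈ szSector (Λ := FermionTorus 2 (2 * k + 1 + 1)) (2 * ⌊(1 - δ) * ((2 * k + 1 + 1 : ℕ) : ℝ) ^ 2 / 2⌋₊ + 2) 0 → 2 * (star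 w ⬝ᵥ ((pairFieldAt dWaveFormFactor (2 * k + 1 + 1) m)ᴴ *ᵥ ψ)).re - ((star w ⬝ᵥ (hubbardTorus 2 (2 * k + 1 + 1) 1 U *ᵥ w)).re - (hubbardTorus 2 (2 * k + 1 + 1) 1 U).minEnergyOn (szSector (2 * ⌊(1 - δ) * ((2 * k + 1 + 1 : ℕ) : ℝ) ^ 2 / 2⌋₊ + 2) 0) * (star w ⬝ᵥ w).re) ≤ C * ((2 * k + 1 + 1 : ℕ) : ℝ) ^ 2 / momentumNormSq (2 * k + 1 + 1) m)) → (∃ U₀ : ℝ, 0 < U₀ ∧ ∀ U ∈ Set.Ioo (0:ℝ) U₀, ∀ δ ∈ Set.Ioo (0:ℝ) (1 / 2), ∀ μ : ℝ, Filter.Tendsto (fun L : ℕ => ((hubbardTorusWith 2 (L + 1) 1 U μ).groundStateFunctional totalNumber).re / ((L + 1 : ℕ) : ℝ) ^ 2) Filter.atTop (nhds (1 - δ)) → (∀ᶠ μ' in nhds μ, HasDWaveOrder U μ') → ∀ R : ℕ, 0 < R → ∃ C : ℝ, 0 ≤ C ∧ ∃ κ₀ : ℝ, 0 < κ₀ ∧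 ∃ h₀ : ℝ, 0 < h₀ ∧ ∀ κ ∈ Set.Ioo (0:ℝ) κ₀, ∀ h ∈ Set.Ioo (0:ℝ) h₀, ∀ᶠ L : ℕ in Filter.atTop, -C * κ ^ 2 * ((L + 1 : ℕ) : ℝ) ^ 2 ≤ (dWaveSourceTorus (L + 1) U μ h + (κ : ℂ) • (((((R : ℝ) ^ 4)⁻¹ : ℝ) : ℂ) • ∑ a : Literature.Probability.LatticeModels.TorusSite 2 (L + 1), (∑ u : Fin 2 → Fin R, localPair dWaveFormFactor (L + 1) (a + fun i => ((u i : ℕ) : ZMod (L + 1))))ᴴ * (∑ u : Fin 2 → Fin R, localPair dWaveFormFactor (L + 1) (a + fun i => ((u i : ℕ) : ZMod (L + 1)))))).groundEnergy + (dWaveSourceTorus (L + 1) U μ h + ((-κ : ℝ) : ℂ) • (((((R : ℝ) ^ 4)⁻¹ : ℝ) : ℂ) • ∑ a : Literature.Probability.LatticeModels.TorusSite 2 (L + 1), (∑ u : Fin 2 → Fin R, localPair dWaveFormFactor (L + 1) (a + fun i => ((u i : ℕ) : ZMod (L + 1))))ᴴ * (∑ u : Fin 2 → Fin R, localPair dWaveFormFactor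 (L + 1) (a + fun i => ((u i : ℕ) : ZMod (L + 1)))))).groundEnergy - 2 * (dWaveSourceTorus (L + 1) U μ h).groundEnergy) → (∃ U₀ : ℝ, 0 < U₀ ∧ ∀ U ∈ Set.Ioo (0:ℝ) U₀, ∀ δ ∈ Set.Ioo (0:ℝ) (1 / 2), ∀ μ : ℝ, Filter.Tendsto (fun L : ℕ => ((hubbardTorusWith 2 (L + 1) 1 U μ).groundStateFunctional totalNumber).re / ((L + 1 : ℕ) : ℝ) ^ 2) Filter.atTop (nhds (1 - δ)) → (∀ᶠ μ' in nhds μ, HasDWaveOrder U μ') → ∀ ε : ℝ, 0 < ε → ∀ᶠ k : ℕ in Filter.atTop, -ε ≤ (1 + Real.log ((2 * k + 1 + 1 : ℕ) : ℝ)) * pairGap (hubbardTorus 2 (2 * k + 1 + 1) 1 U) (2 * ⌊(1 - δ) * ((2 * k + 1 + 1 : ℕ) : ℝ) ^ 2 / 2⌋₊)) → (∀ U₁ : ℝ, 0 < U₁ → ∃ U ∈ Set.Ioo (0:ℝ) U₁, ∃ a b : ℝ, -(21:ℝ) / 25 ≤ a ∧ a < b ∧ b ≤ -(7:ℝ) /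 20 ∧ ∀ μ ∈ Set.Ioo a b, HasDWaveOrder U μ) → _root_.HubbardSuperconductivity := by
  intro hT hN hC hthin
  obtain ⟨U₀, hU₀, h2⟩ := robustTransfer_of_robustChildren hT hN hC
  obtain ⟨U₃, hU₃, hT3⟩ := stub_aeDensityMatching (stub_densityInsideUnitWindow stub_freeLevelCountsOuter)
  obtain ⟨U, hU, a, b, ha, hab, hb, hord⟩ := hthin (min U₀ U₃) (lt_min hU₀ hU₃)
  have hUU₀ : U ∈ Set.Ioo (0:ℝ) U₀ := ⟨hU.1, lt_of_lt_of_le hU.2 (min_le_left _ _)⟩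
  have hUU₃ : U ∈ Set.Icc (0:ℝ) U₃ := ⟨hU.1.le, (lt_of_lt_of_le hU.2 (min_le_right _ _)).le⟩
  obtain ⟨μ, hμ, δ, hδ, hdens⟩ := hT3 U hUU₃ a b ha hab hb
  have hnb : ∀ᶠ μ' in nhds μ, HasDWaveOrder U μ' :=
    Filter.eventually_of_mem (Ioo_mem_nhds hμ.1 hμ.2) hord
  exact ⟨U, hU.1, δ, hδ, h2 U hUU₀ δ hδ μ hdens hnb⟩

end Summit.HubbardSuperconductivity.HubbardSuperconductivity.Theorems.WcbcsSsbToTorusLRO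

end
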